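import Summits.Ventures.PercRepro.RankLevelSetExplicitLin2ArithB1

/-!
# PercRepro — THE ARITHMETIC OF THEOREM P⁗″, PART B2: THE SMALL CLASS IN REGIMES II / III (THE DECAY), THE BIG
CLASS AT EVERY CORANK, AND THE ASSEMBLED INEQUALITY `(P_d)` AT `p ≥ Tq q = q·2^{q+1}` (p9, S4)

`proofs/SUBCLAIM-S4-p9.md` §S4.2⁗′. The continuation of `RankLevelSetExplicitLin2ArithB1`: past the saturation corank
`m_s = 5·2^{q−4} − q` the small-class weight index stays `m_s` while `2^{d−q}` keeps growing, and the three small-class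
terms (degree `≤ 4` in `d`) are bounded through `(m_s + t)^k ≤ m_s^k·2^{t−4}` (`t = d − m_s ≥ q + 1 ≥ 8`); the big
class `C((q+3)d + 2q − 2, q)` is compared with `μ_b·2^{d−μ_b}·C(p+q, q)` at every corank by `(q+5)^q ≤ 149·q^q`,
`(μ_b + t)^q ≤ μ_b^q·2^t` and `19072·5^{q−1} ≤ 16^q`; `weight_bound2` turns each term bound into a bound on the
weighted class in `ℚ`, and `poly_main2` adds them up: `8·(C(n,q) + W_s·A + W_b·B) ≤ 7·2^{d−q}·C(p+q, q)`.
Axioms: standard.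
-/

namespace PercRepro

namespace ThmN

namespace Explicit

/-- The decay facts of regimes II / III: for `d > 5·2^{q−4}`, `t := d − m_s ≥ q + 1 ≥ 8` with `m_s = 5·2^{q−4} − q`,
`m_s ≥ 4·2^{q−4} ≥ 64`, `m_s + 2 ≤ 6·2^{q−4}`. -/
theorem regime_II_facts (q d : ℕ) (hq : 8 ≤ q) (hd : 5 * 2 ^ (q - 4) < d) :
    8 ≤ d - (5 * 2 ^ (q - 4) - q) ∧ 4 * 2 ^ (q - 4) ≤ 5 * 2 ^ (q - 4) - q ∧ 64 ≤ 5 * 2 ^ (q - 4) - q ∧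
      5 * 2 ^ (q - 4) - q + 2 ≤ 6 * 2 ^ (q - 4) ∧ 5 * 2 ^ (q - 4) - q + (d - (5 * 2 ^ (q - 4) - q)) = d := by
  have hx := le_two_pow_sub_four q (by omega)
  have h16 : 16 ≤ 2 ^ (q - 4) := by
    calc 16 = 2 ^ 4 := by norm_num
      _ ≤ 2 ^ (q - 4) := Nat.pow_le_pow_right (by norm_num) (by omega)
  omega

/-- **(S3′), regimes II / III**: `24·2^q·d(d+1)·C(p+d, q−2) ≤ m_s·2^{d−m_s}·C(p+q, q)` for `d > 5·2^{q−4}`. -/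
theorem small_three_II (q d p : ℕ) (hq : 8 ≤ q) (hd1 : q + 1 ≤ d) (hd2 : d ≤ q + 2 ^ q) (hp : Tq q ≤ p)
    (hdII : 5 * 2 ^ (q - 4) < d) :
    24 * 2 ^ q * (d * (d + 1)) * (p + d).choose (q - 2) ≤
      (5 * 2 ^ (q - 4) - q) * 2 ^ (d - (5 * 2 ^ (q - 4) - q)) * (p + q).choose q := by
  obtain ⟨h2, -, -, -⟩ := small_ratios2 q d p hq hd1 hd2 hp
  obtain ⟨hdown, -, -⟩ := levels_down2 p q (by omega)
  obtain ⟨hp2, -, -, hp1⟩ := p_lin2_bounds q p hq hp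
  obtain ⟨-, h16, -, -⟩ := two_pow_facts2 q hq
  obtain ⟨ht8, hm4, hm64, hm6, hsum⟩ := regime_II_facts q d hq hdII
  set x := 2 ^ (q - 4) with hx
  set m := 5 * x - q with hm
  set t := d - m with ht
  have hdt : d = m + t := by omega
  -- `(d + 1)² = (m + 1 + t)² ≤ (m + 1)²·2^{t−4}`
  have hdec : (d + 1) ^ 2 ≤ (m + 1) ^ 2 * 2 ^ (t - 4) := by
    rw [hdt, show m + t + 1 = m + 1 + t by ring]
    exact add_pow_le_pow_mul_two_pow_sub_four (m + 1) t 2 (by omega) ht8 (by norm_num)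
  have h2t : 2 ^ t = 16 * 2 ^ (t - 4) := by
    obtain ⟨s, hs⟩ : ∃ s, t = s + 4 := ⟨t - 4, by omega⟩
    rw [hs, Nat.add_sub_cancel, pow_add]; norm_num; ring
  have hkey : 48 * 2 ^ q * (d * (d + 1)) * q ^ 2 ≤ m * 2 ^ t * p ^ 2 := by
    have hm5 : m + 1 ≤ 5 * x := by omega
    calc 48 * 2 ^ q * (d * (d + 1)) * q ^ 2 ≤ 48 * 2 ^ q * ((d + 1) * (d + 1)) * q ^ 2 := by gcongr; omega
      _ = 48 * 2 ^ q * (d + 1) ^ 2 * q ^ 2 := by ring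
      _ ≤ 48 * 2 ^ q * ((m + 1) ^ 2 * 2 ^ (t - 4)) * q ^ 2 := by gcongr
      _ ≤ 48 * (16 * x) * ((5 * x) ^ 2 * 2 ^ (t - 4)) * q ^ 2 := by rw [h16]; gcongr
      _ = 2 ^ (t - 4) * (19200 * (x ^ 3 * q ^ 2)) := by ring
      _ ≤ 2 ^ (t - 4) * (65536 * (x ^ 3 * q ^ 2)) := Nat.mul_le_mul_left _ (Nat.mul_le_mul_right _ (by norm_num))
      _ = (4 * x) * (16 * 2 ^ (t - 4)) * (4 * q ^ 2 * (16 * x) ^ 2) := by ring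
      _ ≤ m * 2 ^ t * p ^ 2 := by rw [h2t, ← h16]; gcongr
  have hpos : 0 < p ^ 2 := by positivity
  apply Nat.le_of_mul_le_mul_right _ hpos
  calc 24 * 2 ^ q * (d * (d + 1)) * (p + d).choose (q - 2) * p ^ 2
      ≤ 24 * 2 ^ q * (d * (d + 1)) * (2 * (p + q).choose (q - 2)) * p ^ 2 := by gcongr
    _ = 48 * 2 ^ q * (d * (d + 1)) * (p ^ 2 * (p + q).choose (q - 2)) := by ring
    _ ≤ 48 * 2 ^ q * (d * (d + 1)) * (q ^ 2 * (p + q).choose q) := Nat.mul_le_mul_left _ hdown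
    _ = (48 * 2 ^ q * (d * (d + 1)) * q ^ 2) * (p + q).choose q := by ring
    _ ≤ (m * 2 ^ t * p ^ 2) * (p + q).choose q := Nat.mul_le_mul_right _ hkey
    _ = m * 2 ^ t * (p + q).choose q * p ^ 2 := by ring

/-- **(S4′), regimes II / III**: `32·2^q·d(d+1)(d+2)·C(p+d, q−3) ≤ m_s·2^{d−m_s}·C(p+q, q)` for `d > 5·2^{q−4}`. -/
theorem small_four_II (q d p : ℕ) (hq : 8 ≤ q) (hd1 : q + 1 ≤ d) (hd2 : d ≤ q + 2 ^ q) (hp : Tq q ≤ p)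
    (hdII : 5 * 2 ^ (q - 4) < d) :
    32 * 2 ^ q * (d * (d + 1) * (d + 2)) * (p + d).choose (q - 3) ≤
      (5 * 2 ^ (q - 4) - q) * 2 ^ (d - (5 * 2 ^ (q - 4) - q)) * (p + q).choose q := by
  obtain ⟨-, h3, -, -⟩ := small_ratios2 q d p hq hd1 hd2 hp
  obtain ⟨-, hdown, -⟩ := levels_down2 p q (by omega)
  obtain ⟨-, hp3, -, hp1⟩ := p_lin2_bounds q p hq hp
  obtain ⟨-, h16, -, -⟩ := two_pow_facts2 q hq
  obtain ⟨ht8, hm4, hm64, hm6, hsum⟩ := regime_II_facts q d hq hdII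
  set x := 2 ^ (q - 4) with hx
  set m := 5 * x - q with hm
  set t := d - m with ht
  have hdt : d = m + t := by omega
  have hdec : (d + 2) ^ 3 ≤ (m + 2) ^ 3 * 2 ^ (t - 4) := by
    rw [hdt, show m + t + 2 = m + 2 + t by ring]
    exact add_pow_le_pow_mul_two_pow_sub_four (m + 2) t 3 (by omega) ht8 (by norm_num)
  have h2t : 2 ^ t = 16 * 2 ^ (t - 4) := by
    obtain ⟨s, hs⟩ : ∃ s, t = s + 4 := ⟨t - 4, by omega⟩
    rw [hs, Nat.add_sub_cancel, pow_add]; norm_num; ring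
  have hkey : 64 * 2 ^ q * (d * (d + 1) * (d + 2)) * q ^ 3 ≤ m * 2 ^ t * p ^ 3 := by
    calc 64 * 2 ^ q * (d * (d + 1) * (d + 2)) * q ^ 3 ≤ 64 * 2 ^ q * ((d + 2) * (d + 2) * (d + 2)) * q ^ 3 := by
          gcongr <;> omega
      _ = 64 * 2 ^ q * (d + 2) ^ 3 * q ^ 3 := by ring
      _ ≤ 64 * 2 ^ q * ((m + 2) ^ 3 * 2 ^ (t - 4)) * q ^ 3 := by gcongr
      _ ≤ 64 * (16 * x) * ((6 * x) ^ 3 * 2 ^ (t - 4)) * q ^ 3 := by rw [h16]; gcongr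
      _ = 2 ^ (t - 4) * (221184 * (x ^ 4 * q ^ 3)) := by ring
      _ ≤ 2 ^ (t - 4) * (2097152 * (x ^ 4 * q ^ 3)) := Nat.mul_le_mul_left _ (Nat.mul_le_mul_right _ (by norm_num))
      _ = (4 * x) * (16 * 2 ^ (t - 4)) * (8 * q ^ 3 * (16 * x) ^ 3) := by ring
      _ ≤ m * 2 ^ t * p ^ 3 := by rw [h2t, ← h16]; gcongr
  have hpos : 0 < p ^ 3 := by positivity
  apply Nat.le_of_mul_le_mul_right _ hpos
  calc 32 * 2 ^ q * (d * (d + 1) * (d + 2)) * (p + d).choose (q - 3) * p ^ 3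
      ≤ 32 * 2 ^ q * (d * (d + 1) * (d + 2)) * (2 * (p + q).choose (q - 3)) * p ^ 3 := by gcongr
    _ = 64 * 2 ^ q * (d * (d + 1) * (d + 2)) * (p ^ 3 * (p + q).choose (q - 3)) := by ring
    _ ≤ 64 * 2 ^ q * (d * (d + 1) * (d + 2)) * (q ^ 3 * (p + q).choose q) := Nat.mul_le_mul_left _ hdown
    _ = (64 * 2 ^ q * (d * (d + 1) * (d + 2)) * q ^ 3) * (p + q).choose q := by ring
    _ ≤ (m * 2 ^ t * p ^ 3) * (p + q).choose q := Nat.mul_le_mul_right _ hkey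
    _ = m * 2 ^ t * (p + q).choose q * p ^ 3 := by ring

/-- **(S5′), regimes II / III**: `96·2^q·C(2d+2q−2, 4)·C(2d+2q−6+(p+d), q−4) ≤ 3·m_s·2^{d−m_s}·C(p+q, q)` for
`d > 5·2^{q−4}`. -/
theorem small_five_II (q d p : ℕ) (hq : 8 ≤ q) (hd1 : q + 1 ≤ d) (hd2 : d ≤ q + 2 ^ q) (hp : Tq q ≤ p)
    (hdII : 5 * 2 ^ (q - 4) < d) :
    96 * 2 ^ q * (2 * d + 2 * q - 2).choose 4 * (2 * d + 2 * q - 6 + (p + d)).choose (q - 4) ≤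
      3 * (5 * 2 ^ (q - 4) - q) * 2 ^ (d - (5 * 2 ^ (q - 4) - q)) * (p + q).choose q := by
  obtain ⟨-, -, h8, h4⟩ := small_ratios2 q d p hq hd1 hd2 hp
  obtain ⟨-, -, hdown⟩ := levels_down2 p q (by omega)
  obtain ⟨-, -, hp4, hp1⟩ := p_lin2_bounds q p hq hp
  obtain ⟨-, h16, -, -⟩ := two_pow_facts2 q hq
  obtain ⟨ht8, hm4, hm64, hm6, hsum⟩ := regime_II_facts q d hq hdII
  set x := 2 ^ (q - 4) with hx
  set m := 5 * x - q with hm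
  set t := d - m with ht
  have hdt : d = m + t := by omega
  have hdec : d ^ 4 ≤ m ^ 4 * 2 ^ (t - 4) := by
    rw [hdt]
    exact add_pow_le_pow_mul_two_pow_sub_four m t 4 (by omega) ht8 le_rfl
  have h2t : 2 ^ t = 16 * 2 ^ (t - 4) := by
    obtain ⟨s, hs⟩ : ∃ s, t = s + 4 := ⟨t - 4, by omega⟩
    rw [hs, Nat.add_sub_cancel, pow_add]; norm_num; ring
  have hkey : 196608 * 2 ^ q * d ^ 4 * q ^ 4 ≤ 72 * m * 2 ^ t * p ^ 4 := by
    have hm5 : m ≤ 5 * x := by omega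
    calc 196608 * 2 ^ q * d ^ 4 * q ^ 4 ≤ 196608 * 2 ^ q * (m ^ 4 * 2 ^ (t - 4)) * q ^ 4 := by gcongr
      _ ≤ 196608 * (16 * x) * ((5 * x) ^ 4 * 2 ^ (t - 4)) * q ^ 4 := by rw [h16]; gcongr
      _ = 2 ^ (t - 4) * (1966080000 * (x ^ 5 * q ^ 4)) := by ring
      _ ≤ 2 ^ (t - 4) * (4831838208 * (x ^ 5 * q ^ 4)) :=
          Nat.mul_le_mul_left _ (Nat.mul_le_mul_right _ (by norm_num))
      _ = 72 * (4 * x) * (16 * 2 ^ (t - 4)) * (16 * q ^ 4 * (16 * x) ^ 4) := by ring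
      _ ≤ 72 * m * 2 ^ t * p ^ 4 := by rw [h2t, ← h16]; gcongr
  have hpos : 0 < 24 * p ^ 4 := by positivity
  apply Nat.le_of_mul_le_mul_right _ hpos
  calc 96 * 2 ^ q * (2 * d + 2 * q - 2).choose 4 * (2 * d + 2 * q - 6 + (p + d)).choose (q - 4) * (24 * p ^ 4)
      = 96 * 2 ^ q * (24 * (2 * d + 2 * q - 2).choose 4) * (2 * d + 2 * q - 6 + (p + d)).choose (q - 4) * p ^ 4 := by
        ring
    _ ≤ 96 * 2 ^ q * (256 * d ^ 4) * (8 * (p + q).choose (q - 4)) * p ^ 4 := by gcongr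
    _ = 196608 * 2 ^ q * d ^ 4 * (p ^ 4 * (p + q).choose (q - 4)) := by ring
    _ ≤ 196608 * 2 ^ q * d ^ 4 * (q ^ 4 * (p + q).choose q) := Nat.mul_le_mul_left _ hdown
    _ = (196608 * 2 ^ q * d ^ 4 * q ^ 4) * (p + q).choose q := by ring
    _ ≤ (72 * m * 2 ^ t * p ^ 4) * (p + q).choose q := Nat.mul_le_mul_right _ hkey
    _ = 3 * m * 2 ^ t * (p + q).choose q * (24 * p ^ 4) := by ring

/-- **(B), THE BIG CLASS AT EVERY CORANK**: `16·2^q·C((q+3)d + 2q − 2, q) ≤ μ_b·2^{d−μ_b}·C(p+q, q)`,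
`μ_b = min (5·2^{q−3} − q − 1) d`, for `q ≥ 8`, `q + 1 ≤ d ≤ q + 2^q`, `p ≥ Tq q`. -/
theorem big_bound2 (q d p μ : ℕ) (hq : 8 ≤ q) (hd1 : q + 1 ≤ d) (hd2 : d ≤ q + 2 ^ q) (hp : Tq q ≤ p)
    (hμ : μ = min (5 * 2 ^ (q - 3) - q - 1) d) :
    16 * 2 ^ q * ((q + 3) * d + 2 * q - 2).choose q ≤ μ * 2 ^ (d - μ) * (p + q).choose q := by
  obtain ⟨h8, -, -, -⟩ := two_pow_facts2 q hq
  have hx := le_two_pow_sub_four q (by omega)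
  obtain ⟨-, -, -, h23⟩ := two_pow_facts2 q hq
  set y := 2 ^ (q - 3) with hy
  have hy2 : 2 * 2 ^ (q - 4) = y := h23.symm
  have hyq : 3 * q + 3 ≤ 5 * y := by omega
  -- `μ ≤ 5y`, `2q ≤ μ` when `μ < d`, and `Y ≤ (q+5)·d`
  have hμ5 : μ ≤ 5 * y := by rw [hμ]; exact (min_le_left _ _).trans (by omega)
  have hμd : μ ≤ d := by rw [hμ]; exact min_le_right _ _
  have hμ1 : 1 ≤ μ := by rw [hμ]; exact le_min (by omega) (by omega)
  have hY : (q + 3) * d + 2 * q - 2 ≤ (q + 5) * d := by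
    calc (q + 3) * d + 2 * q - 2 ≤ (q + 3) * d + 2 * q := Nat.sub_le _ _
      _ ≤ (q + 3) * d + 2 * d := by omega
      _ = (q + 5) * d := by ring
  -- `(q+5)^q ≤ 149·q^q`
  have hq5 : (q + 5) ^ q ≤ 149 * q ^ q := add_pow_le_one_forty_nine_mul_pow q 5 q (by ring_nf; omega)
  -- `d^q ≤ μ^q·2^{d−μ}` (trivial when `μ = d`, the decay lemma when `μ = m_b ≥ 2q`)
  have hdecay : d ^ q ≤ μ ^ q * 2 ^ (d - μ) := by
    rcases le_total d (5 * 2 ^ (q - 3) - q - 1) with h | h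
    · have : μ = d := by rw [hμ, min_eq_right h]
      rw [this, Nat.sub_self, pow_zero, mul_one]
    · have hμm : μ = 5 * 2 ^ (q - 3) - q - 1 := by rw [hμ, min_eq_left h]
      have h2q : 2 * q ≤ μ := by rw [hμm]; omega
      have := add_pow_le_pow_mul_two_pow μ q h2q (d - μ)
      rwa [show μ + (d - μ) = d by omega] at this
  -- the main comparison: `16·2^q·(q+5)^q·μ^{q−1} ≤ (p+1)^q`
  obtain ⟨-, -, h2q2, -⟩ := Tq_bounds q hq
  have hp1 : 2 * q * 2 ^ q ≤ p + 1 := by omega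
  have hmain : 16 * 2 ^ q * (q + 5) ^ q * μ ^ q ≤ μ * (p + 1) ^ q := by
    obtain ⟨r, hr⟩ : ∃ r, q = r + 1 := ⟨q - 1, by omega⟩
    have hc := big_const_le2 q hq
    rw [show q - 1 = r by omega] at hc
    have hμr : μ ^ q = μ * μ ^ r := by rw [hr, pow_succ]; ring
    have hμ5r : μ ^ r ≤ (5 * y) ^ r := Nat.pow_le_pow_left hμ5 r
    have hpq : (2 * q * 2 ^ q) ^ q ≤ (p + 1) ^ q := Nat.pow_le_pow_left hp1 q
    calc 16 * 2 ^ q * (q + 5) ^ q * μ ^ q = μ * (16 * 2 ^ q * (q + 5) ^ q * μ ^ r) := by rw [hμr]; ring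
      _ ≤ μ * (16 * (8 * y) * (149 * q ^ q) * (5 * y) ^ r) := by rw [h8]; gcongr
      _ = μ * (19072 * 5 ^ r * (q ^ q * (y * y ^ r))) := by ring
      _ ≤ μ * (16 ^ q * (q ^ q * (y * y ^ r))) := by gcongr
      _ = μ * (16 ^ q * q ^ q * y ^ q) := by rw [hr, pow_succ]; ring
      _ = μ * (2 * q * (8 * y)) ^ q := by
          rw [show 2 * q * (8 * y) = 16 * q * y by ring, mul_pow, mul_pow]
      _ = μ * (2 * q * 2 ^ q) ^ q := by rw [h8]
      _ ≤ μ * (p + 1) ^ q := Nat.mul_le_mul_left _ hpq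
  -- assemble: `q!·C(Y,q) ≤ Y^q ≤ ((q+5)d)^q`, `(p+1)^q ≤ q!·C`
  have hfac : 0 < q.factorial := Nat.factorial_pos q
  apply Nat.le_of_mul_le_mul_left _ hfac
  calc q.factorial * (16 * 2 ^ q * ((q + 3) * d + 2 * q - 2).choose q)
      = 16 * 2 ^ q * (q.factorial * ((q + 3) * d + 2 * q - 2).choose q) := by ring
    _ ≤ 16 * 2 ^ q * ((q + 3) * d + 2 * q - 2) ^ q := Nat.mul_le_mul_left _ (factorial_mul_choose_le_pow _ _)
    _ ≤ 16 * 2 ^ q * ((q + 5) * d) ^ q := Nat.mul_le_mul_left _ (Nat.pow_le_pow_left hY q)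
    _ = 16 * 2 ^ q * (q + 5) ^ q * d ^ q := by rw [mul_pow]; ring
    _ ≤ 16 * 2 ^ q * (q + 5) ^ q * (μ ^ q * 2 ^ (d - μ)) := Nat.mul_le_mul_left _ hdecay
    _ = (16 * 2 ^ q * (q + 5) ^ q * μ ^ q) * 2 ^ (d - μ) := by ring
    _ ≤ (μ * (p + 1) ^ q) * 2 ^ (d - μ) := Nat.mul_le_mul_right _ hmain
    _ ≤ (μ * (q.factorial * (p + q).choose q)) * 2 ^ (d - μ) :=
        Nat.mul_le_mul_right _ (Nat.mul_le_mul_left _ (pow_le_factorial_mul_choose p q))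
    _ = q.factorial * (μ * 2 ^ (d - μ) * (p + q).choose q) := by ring

/-- **THE WEIGHT HELPER** (in `ℚ`): a weight `W` with `W·μ ≤ 2^μ`, a class `Z ≤ X` and the term bound
`K·2^q·X ≤ c·μ·2^e·C` with `μ + e ≤ d` give `W·Z·K ≤ c·2^{d−q}·C`. -/
theorem weight_bound2 (q d μ e K c X Z C : ℕ) (W : ℚ) (hW : W * μ ≤ 2 ^ μ) (hμ : 0 < μ) (hZ : Z ≤ X)
    (hX : K * 2 ^ q * X ≤ c * μ * 2 ^ e * C) (hμe : μ + e ≤ d) (hqd : q ≤ d) :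
    W * Z * K ≤ c * 2 ^ (d - q) * (C : ℚ) := by
  have hμq : (0 : ℚ) < μ := by exact_mod_cast hμ
  have hq0 : (0 : ℚ) < 2 ^ q := by positivity
  have hZq : (Z : ℚ) ≤ X := by exact_mod_cast hZ
  have hXq : (K : ℚ) * 2 ^ q * X ≤ c * μ * 2 ^ e * C := by exact_mod_cast hX
  have hZ0 : (0 : ℚ) ≤ Z := Nat.cast_nonneg _
  have hK0 : (0 : ℚ) ≤ K := Nat.cast_nonneg _
  have hC0 : (0 : ℚ) ≤ C := Nat.cast_nonneg _
  have hc0 : (0 : ℚ) ≤ c := Nat.cast_nonneg _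
  have hpow : (2 : ℚ) ^ μ * 2 ^ e ≤ 2 ^ q * 2 ^ (d - q) := by
    rw [← pow_add, ← pow_add]
    exact pow_le_pow_right₀ (by norm_num) (by omega)
  have hpos : (0 : ℚ) < μ * 2 ^ q := by positivity
  apply le_of_mul_le_mul_right _ hpos
  calc W * Z * K * (μ * 2 ^ q) = (W * μ) * (K * 2 ^ q * Z) := by ring
    _ ≤ 2 ^ μ * (K * 2 ^ q * Z) := by gcongr
    _ ≤ 2 ^ μ * (K * 2 ^ q * X) := by gcongr
    _ ≤ 2 ^ μ * (c * μ * 2 ^ e * C) := by gcongr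
    _ = (c * μ * C) * (2 ^ μ * 2 ^ e) := by ring
    _ ≤ (c * μ * C) * (2 ^ q * 2 ^ (d - q)) := by gcongr
    _ = c * 2 ^ (d - q) * C * (μ * 2 ^ q) := by ring

/-- **THE POLYNOMIAL INEQUALITY `(P_d)` OF THEOREM P⁗″** (in `ℚ`): at level `q ≥ 8`, corank `q + 1 ≤ d ≤ q + 2^q`,
`p ≥ Tq q`, with the small-class weight index `μ_s = min (5·2^{q−4} − q) d` (`W_s·μ_s ≤ 2^{μ_s}`), the big-class
weight index `μ_b = min (5·2^{q−3} − q − 1) d` (`W_b·μ_b ≤ 2^{μ_b}`), `6A ≤ A6` (Lemma T, Lemma T4, the `T_k` tail)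
and `B ≤ C((q+3)d + 2q − 2, q)`: `8·(C(p+d, q) + W_s·A + W_b·B) ≤ 7·2^{d−q}·C(p+q, q)`. -/
theorem poly_main2 (q d p μs μb : ℕ) (hq : 8 ≤ q) (hd1 : q + 1 ≤ d) (hd2 : d ≤ q + 2 ^ q)
    (hp : Tq q ≤ p) (hμs : μs = min (5 * 2 ^ (q - 4) - q) d) (hμb : μb = min (5 * 2 ^ (q - 3) - q - 1) d)
    (A B : ℕ) (Ws Wb : ℚ) (hWs : Ws * μs ≤ 2 ^ μs) (hWb : Wb * μb ≤ 2 ^ μb)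
    (hA : 6 * A ≤ 3 * (d * (d + 1)) * (p + d).choose (q - 2) + 2 * (d * (d + 1) * (d + 2)) * (p + d).choose (q - 3) +
      6 * ((2 * d + 2 * q - 2).choose 4 * (2 * d + 2 * q - 6 + (p + d)).choose (q - 4)))
    (hB : B ≤ ((q + 3) * d + 2 * q - 2).choose q) :
    8 * (((p + d).choose q : ℚ) + Ws * A + Wb * B) ≤ 7 * 2 ^ (d - q) * ((p + q).choose q : ℚ) := by
  have hx := le_two_pow_sub_four q (by omega)
  obtain ⟨-, h16, -, h23⟩ := two_pow_facts2 q hq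
  set C := (p + q).choose q with hC
  set A6 := 3 * (d * (d + 1)) * (p + d).choose (q - 2) + 2 * (d * (d + 1) * (d + 2)) * (p + d).choose (q - 3) +
      6 * ((2 * d + 2 * q - 2).choose 4 * (2 * d + 2 * q - 6 + (p + d)).choose (q - 4)) with hA6
  have hμs1 : 0 < μs := by rw [hμs]; exact lt_min (by omega) (by omega)
  have hμb1 : 0 < μb := by rw [hμb]; exact lt_min (by omega) (by omega)
  have hμsd : μs ≤ d := by rw [hμs]; exact min_le_right _ _
  have hμbd : μb ≤ d := by rw [hμb]; exact min_le_right _ _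
  -- (C1)
  have hC1 := c1_bound2 q d p hq hd1 hd2 hp
  have hC1q : 64 * ((p + d).choose q : ℚ) ≤ (64 + 2 ^ (d - q)) * (C : ℚ) := by
    rw [hC]; exact_mod_cast hC1
  -- (B)
  have hBn : 16 * 2 ^ q * B ≤ 1 * μb * 2 ^ (d - μb) * C :=
    (Nat.mul_le_mul_left _ hB).trans (by rw [one_mul]; exact big_bound2 q d p μb hq hd1 hd2 hp hμb)
  have hbig := weight_bound2 q d μb (d - μb) 16 1 B B C Wb hWb hμb1 le_rfl hBn (by omega) (by omega)
  push_cast at hbig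
  have hC0 : (0 : ℚ) ≤ C := Nat.cast_nonneg _
  have hdq2 : (2 : ℚ) ≤ 2 ^ (d - q) := by
    calc (2 : ℚ) = 2 ^ 1 := by norm_num
      _ ≤ 2 ^ (d - q) := pow_le_pow_right₀ (by norm_num) (by omega)
  -- the small class, by regime
  rcases le_or_gt d (5 * 2 ^ (q - 4)) with hdI | hdII
  · -- regime I′
    have h3 := small_three_I q d p μs hq hd1 hd2 hp hμs hdI
    have h4 := small_four_I q d p μs hq hd1 hd2 hp hμs hdI
    have h5 := small_five_I q d p μs hq hd1 hd2 hp hμs hdI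
    have hS : 4 * 2 ^ q * A6 ≤ 13 * μs * 2 ^ 0 * C := by
      rw [pow_zero, mul_one]
      have : 16 * 2 ^ q * A6 ≤ 52 * μs * C := by
        calc 16 * 2 ^ q * A6 = 2 * (24 * 2 ^ q * (d * (d + 1)) * (p + d).choose (q - 2)) +
              32 * 2 ^ q * (d * (d + 1) * (d + 2)) * (p + d).choose (q - 3) +
              96 * 2 ^ q * (2 * d + 2 * q - 2).choose 4 * (2 * d + 2 * q - 6 + (p + d)).choose (q - 4) := by
              rw [hA6]; ring
          _ ≤ 2 * (7 * μs * C) + 3 * μs * C + 35 * μs * C := by gcongr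
          _ = 52 * μs * C := by ring
      have h4 : 4 * (4 * 2 ^ q * A6) ≤ 4 * (13 * μs * C) := by
        calc 4 * (4 * 2 ^ q * A6) = 16 * 2 ^ q * A6 := by ring
          _ ≤ 52 * μs * C := this
          _ = 4 * (13 * μs * C) := by ring
      exact Nat.le_of_mul_le_mul_left h4 (by norm_num)
    rcases Nat.lt_or_ge (q + 1) d with hd3 | hd3
    · -- `d ≥ q + 2`: budget `13/3`
      have hsmall := weight_bound2 q d μs 0 4 13 A6 (6 * A) C Ws hWs hμs1 hA hS (by omega) (by omega)
      push_cast at hsmall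
      have hdq4 : (4 : ℚ) ≤ 2 ^ (d - q) := by
        calc (4 : ℚ) = 2 ^ 2 := by norm_num
          _ ≤ 2 ^ (d - q) := pow_le_pow_right₀ (by norm_num) (by omega)
      have := mul_le_mul_of_nonneg_right hdq4 hC0
      nlinarith
    · -- `d = q + 1`: budget `2`
      have hd' : d = q + 1 := by omega
      subst hd'
      have hS6 : 4 * 2 ^ q * A6 ≤ 6 * μs * 2 ^ 0 * C := by
        rw [pow_zero, mul_one, hA6]
        exact small_I_succ q p μs hq hp hμs
      have hsmall := weight_bound2 q (q + 1) μs 0 4 6 A6 (6 * A) C Ws hWs hμs1 hA hS6 (by omega) (by omega)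
      push_cast at hsmall
      have e1 : (2 : ℚ) ^ (q + 1 - q) = 2 := by rw [show q + 1 - q = 1 by omega, pow_one]
      rw [e1] at hsmall hbig hC1q ⊢
      nlinarith
  · -- regimes II / III: the small-class weight saturates at `m_s` and decays
    obtain ⟨ht8, hm4, hm64, hm6, hsum⟩ := regime_II_facts q d hq hdII
    have hμsm : μs = 5 * 2 ^ (q - 4) - q := by rw [hμs, min_eq_left (by omega)]
    have h3 := small_three_II q d p hq hd1 hd2 hp hdII
    have h4 := small_four_II q d p hq hd1 hd2 hp hdII
    have h5 := small_five_II q d p hq hd1 hd2 hp hdII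
    rw [← hμsm] at h3 h4 h5
    have hS : 8 * 2 ^ q * A6 ≤ 3 * μs * 2 ^ (d - μs) * C := by
      have : 16 * 2 ^ q * A6 ≤ 6 * μs * 2 ^ (d - μs) * C := by
        calc 16 * 2 ^ q * A6 = 2 * (24 * 2 ^ q * (d * (d + 1)) * (p + d).choose (q - 2)) +
              32 * 2 ^ q * (d * (d + 1) * (d + 2)) * (p + d).choose (q - 3) +
              96 * 2 ^ q * (2 * d + 2 * q - 2).choose 4 * (2 * d + 2 * q - 6 + (p + d)).choose (q - 4) := by
              rw [hA6]; ring
          _ ≤ 2 * (μs * 2 ^ (d - μs) * C) + μs * 2 ^ (d - μs) * C + 3 * μs * 2 ^ (d - μs) * C := by gcongr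
          _ = 6 * μs * 2 ^ (d - μs) * C := by ring
      have h2 : 2 * (8 * 2 ^ q * A6) ≤ 2 * (3 * μs * 2 ^ (d - μs) * C) := by
        calc 2 * (8 * 2 ^ q * A6) = 16 * 2 ^ q * A6 := by ring
          _ ≤ 6 * μs * 2 ^ (d - μs) * C := this
          _ = 2 * (3 * μs * 2 ^ (d - μs) * C) := by ring
      exact Nat.le_of_mul_le_mul_left h2 (by norm_num)
    have hsmall := weight_bound2 q d μs (d - μs) 8 3 A6 (6 * A) C Ws hWs hμs1 hA hS (by omega) (by omega)
    push_cast at hsmall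
    have := mul_le_mul_of_nonneg_right hdq2 hC0
    nlinarith

end Explicit

end ThmN

end PercRepro
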